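import Literature.Analysis.FluidPDE.Wei2016RayTransfer
import HarnessLib

/-!
# Integrable axisymmetric scalars have integrable weighted profiles on the meridian half-plane
# (`dx = r dr dθ dz`: `∫ G dx = c₂ ∫∫_{ρ>0} ρ G(ρ, 0, z) dρ dz`)

Analysis/FluidPDE proof file (theorems only) on the way to
`Literature.Analysis.FluidPDE.Wei2016_logModulus_regularity`
(`LeiZhang2017AxisymmetricCriteria.lean`), after D. Wei, J. Math. Anal. Appl. 435 (2016) =
arXiv:1508.03318, §2: "If `|f|²` is axially symmetric, we will denote
`‖f‖²_{L²} = ∫ |f|² r dr dz`, `dx = r dr dz`." The half-plane lemmas of the Wei files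
(`Wei2016SupLemma.lean`, Lemma 2.2) take the finiteness of such double integrals as hypotheses;
this file derives them from integrability on `ℝ³`:

* `Wei2016.integrable_weightedProfile` — for a continuous integrable axisymmetric scalar `G`,
  `(ρ, z) ↦ ρ G(ρ, 0, z)` is integrable on `(0, ∞) × ℝ`;
* `Wei2016.integral_weightedProfile` — and `c₂ ∫∫_{ρ>0} ρ G(ρ, 0, z) = ∫ G dx`
  (`c₂ = radialConst₂ = 2π`).

Proof: Fubini in the splitting `x ↦ (x₂, (x₀, x₁))` and polar coordinates in the horizontal plane
(`integrable_fun_norm_addHaar`, `IsAxisymmetricScalar.integral_slice_eq` of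
`CylindricalIntegration.lean`; the a.e. slice integrability `ae_integrableOn_profile` of
`Wei2016RayTransfer.lean`), assembled with `integrable_prod_iff'`.

## References

* D. Wei, arXiv:1508.03318, §2 (the convention `dx = r dr dz`). [Wei2016]
-/

noncomputable section

open MeasureTheory Set Function Filter Topology
open scoped ENNReal

namespace Literature.Analysis.FluidPDE

namespace Wei2016

/-- For a continuous integrable axisymmetric scalar `G` on `ℝ³`, the `z`-sections satisfy
`∫_{(0,∞)} ρ |G(ρ, 0, z)| dρ = c₂⁻¹ ∫_{ℝ²} |G(w₀, w₁, z)| dw` for every `z`. [folklore] -/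
theorem integral_norm_weightedProfile_eq {G : EuclideanSpace ℝ (Fin 3) → ℝ}
    (hG : IsAxisymmetricScalar G) (z : ℝ) :
    ∫ ρ in Ioi (0 : ℝ), ‖ρ * G (meridianPoint (ρ, z))‖ =
      radialConst₂⁻¹ * ∫ w : EuclideanSpace ℝ (Fin 2), ‖G (cylSplit.symm (z, w))‖ := by
  have habs : IsAxisymmetricScalar fun x => ‖G x‖ := fun θ x => by simp only [hG θ x]
  have h := habs.integral_slice_eq z
  rw [h, smul_eq_mul, ← mul_assoc, inv_mul_cancel₀ radialConst₂_pos.ne', one_mul]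
  refine setIntegral_congr_fun measurableSet_Ioi fun ρ hρ => ?_
  rw [norm_mul, Real.norm_of_nonneg (le_of_lt hρ), smul_eq_mul]

/-- **Integrability of the weighted profile.** For a continuous integrable axisymmetric scalar
`G` on `ℝ³`, `(ρ, z) ↦ ρ G(ρ, 0, z)` is integrable on the half-plane `(0, ∞) × ℝ`. [folklore] -/
theorem integrable_weightedProfile {G : EuclideanSpace ℝ (Fin 3) → ℝ} (hG : IsAxisymmetricScalar G)
    (hGc : Continuous G) (hGi : Integrable G) :
    IntegrableOn (fun p : ℝ × ℝ => p.1 * G (meridianPoint (p.1, p.2))) (Ioi 0 ×ˢ univ) := by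
  -- as a statement on the product measure `(vol|(0,∞)) × vol`
  have hprod : (volume : Measure (ℝ × ℝ)).restrict (Ioi (0 : ℝ) ×ˢ (univ : Set ℝ)) =
      ((volume : Measure ℝ).restrict (Ioi 0)).prod (volume : Measure ℝ) := by
    rw [Measure.volume_eq_prod, ← Measure.prod_restrict, Measure.restrict_univ]
  rw [IntegrableOn, hprod]
  have hmeas : AEStronglyMeasurable (fun p : ℝ × ℝ => p.1 * G (meridianPoint (p.1, p.2)))
      (((volume : Measure ℝ).restrict (Ioi 0)).prod (volume : Measure ℝ)) := by
    have hc : Continuous fun p : ℝ × ℝ => p.1 * G (meridianPoint (p.1, p.2)) :=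
      continuous_fst.mul (hGc.comp (contDiff_meridianPoint (n := 0)).continuous)
    exact hc.aestronglyMeasurable
  rw [integrable_prod_iff' hmeas]
  constructor
  · -- a.e. `z`: the ray profile is integrable (`Wei2016RayTransfer`)
    filter_upwards [ae_integrableOn_profile hG hGi] with z hz
    exact hz
  · -- the `z`-function of norms is `c₂⁻¹ ∫_{ℝ²} |G(·, z)|`, integrable by Fubini in `(z, w)`
    have h1 : Integrable (fun p : ℝ × EuclideanSpace ℝ (Fin 2) => G (cylSplit.symm p))
        ((volume : Measure ℝ).prod volume) := integrable_comp_cylSplit_symm_iff.2 hGi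
    have h2 := h1.integral_norm_prod_left.const_mul radialConst₂⁻¹
    refine h2.congr (Eventually.of_forall fun z => ?_)
    exact (integral_norm_weightedProfile_eq hG z).symm

/-- **The value of the weighted profile integral**: `c₂ ∫∫_{ρ>0} ρ G(ρ, 0, z) dρ dz = ∫ G dx`
(`dx = r dr dθ dz`). [cite: Wei2016, §2 (dx = r dr dz)] -/
theorem integral_weightedProfile {G : EuclideanSpace ℝ (Fin 3) → ℝ} (hG : IsAxisymmetricScalar G)
    (hGc : Continuous G) (hGi : Integrable G) :
    radialConst₂ * ∫ p in Ioi (0 : ℝ) ×ˢ (univ : Set ℝ), p.1 * G (meridianPoint (p.1, p.2)) = ∫ x, G x := by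
  have hprod : (volume : Measure (ℝ × ℝ)).restrict (Ioi (0 : ℝ) ×ˢ (univ : Set ℝ)) =
      ((volume : Measure ℝ).restrict (Ioi 0)).prod (volume : Measure ℝ) := by
    rw [Measure.volume_eq_prod, ← Measure.prod_restrict, Measure.restrict_univ]
  have hint := integrable_weightedProfile hG hGc hGi
  rw [IntegrableOn, hprod] at hint
  rw [hprod, integral_prod_symm _ hint, hG.integral_eq hGi, ← integral_const_mul]
  refine integral_congr_ae (Eventually.of_forall fun z => ?_)
  simp only [smul_eq_mul]

end Wei2016

end Literature.Analysis.FluidPDE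

end
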